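/-
COR-CM (cells pub-hodgecm / pub-hodgecm2, stage 2 of the Hodge ladder) — Δ2 BRIDGE, COORDINATOR «Δ2 RESTRUCTURE FOR SPEED» 2026-08-23,
sublemma S1 AT THE PIN (seats d2bridge-prove-1 g0 ∕ g1): the `HcmPieces` fields `dLiu : ℚ → CM` and `admLiu : ∀ q, adm (dLiu q)`
(`CorCM/D2Bridge/HcmPieces.lean`, S1 block) at the model's CM records `CM := HodgeCM.Model.LiuCMSide` and the model's admissibility
predicate `adm := (·).IsReflexOfTypeG ι₁ Φ_μ` (the pinned dictionary's `adm i d := d.IsReflexOfTypeG ι₁ (typeOfLine (line i))`, read at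
`Φ_μ` and transported along the X3-Char identification `Φ_μ = (line i).lineType` by `admLiu_of_eq`).  The record is LIU'S OWN CM datum
`D_μ = X : Def45.CMDatum (AlgHom.id ℚ L) ι₁ hμ hw Car` ([Liu2021] Def. 4.5 (2) AS PRINTED) on its principal model (the NAMED witnesses
`liuModel ∕ liuModelIso ∕ liuModelRing ∕ liuModelAction ∕ liuModel_isCMTypeRealisation ∕ liuModelClass` of `CorCM/D2Bridge/HcmS1LiuRecordData.lean`,
projections of the S1 core `exists_liuCMRecord_of_cmDatum`, `CorCM/D2Bridge/HcmS1LiuCMRecord.lean`), its admissibility is R2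
(`Transposition.isReflexOfType_of_reflexCMType`, `CorCM/B01/Transposition/Item6PinMatchReflexPairPkg.lean`) at `e := RingEquiv.refl`.
ONE definition (`dLiu`, a `LiuCMSide` record of tree constants; no instance, no structure) + theorems; no named fact; nothing landed is
edited or restated.  FRAMING: HC_CM is NOT proved; «Δ2 BRIDGE CLOSED» is NOT claimed; no pointer moves.
-/
import Summits.HodgeConjecture.CorCM.D2Bridge.HcmS1LiuRecordData
import Summits.HodgeConjecture.CorCM.B01.Transposition.Item6PinMatchReflexPairPkg
import HarnessLib

set_option autoImplicit false

/-!
# Δ2 bridge, S1 at the pin: `dLiu q : LiuCMSide` and `admLiu`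

For `L : HodgeCM.CMField` Galois over `ℚ`, the pin `ι₁`, a conjugate-symplectic weight-one `μ`, one object `X : Def45.CMDatum (AlgHom.id ℚ L) ι₁ hμ hw Car`
of [Liu2021] Def. 4.5 (2) and Liu's eigenclass `(α₀, hα₀, hα₀0)` (proof of Thm. 4.18, `FJcycle.tex` l. 2250; `CorCM/D2Bridge/HcmS1LiuEigenclass.lean`):
* `dLiu … q : LiuCMSide` — `(K', Φ') := (M'_μ, Ψ_μ)` the TREE reflex pair of `(L, Φ_μ)` at `ι₁`, `M := M_μ`, `k := e_μ`, `(A, ιA, θA) :=` the principal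
  model of `A_μ ⊗_{L,ι₁} ℂ`, `ΦA := Ψ̃_μ` THE INFLATED REFLEX TYPE, `τ := (M_μ ⊆ ℂ)`, `α := q • liuModelClass` (the `ℚ`-family of `HcmPieces.dLiu`);
* `admLiu … q : (dLiu … q).IsReflexOfTypeG ι₁ Φ_μ` — admissibility (Def. 4.5 (2) ⇒ admissible CM type), and `admLiu_of_eq` its transport to any
  `Φ' = Φ_μ` (the pinned dictionary reads `adm` at `(line i).lineType`);
* `baseChange_pull_dLiu_α` — the S4 law `(f ≫ u)^* (dLiu q).α = q • f^* α₀` (`u = liuModelIso`), so S4's `f_of φ := f_φ ≫ u`.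

References: Y. Liu, arXiv:2102.11518 = Camb. J. Math. 9 (2021), Def. 4.3 (2) (`FJcycle.tex` l. 1914–1921), Def. 4.5 (2) (l. 1944–1951), proof of
Thm. 4.18 (l. 2246–2253); G. Shimura, *Abelian Varieties with Complex Multiplication and Modular Functions* (1998) §7.1 Prop. 7, §8.3 Prop. 28.
HC_CM is NOT proved.
-/

noncomputable section

open scoped TensorProduct

namespace Summit.HodgeConjecture.CorCM.D2Bridge

open CategoryTheory NumberField
open Literature.AlgebraicGeometry.Motives Literature.AlgebraicGeometry.HodgeTheory
open Literature.AlgebraicGeometry.ComplexMultiplication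
open Literature.NumberTheory.ComplexMultiplication Literature.NumberTheory.Automorphic
open Literature.NumberTheory.Automorphic.IdeleClassGroup Literature.NumberTheory.Automorphic.PicardCM
open Literature.NumberTheory.Automorphic.Liu2021
open HodgeCM.Model (LiuCMSide)

section Pin

variable {L : HodgeCM.CMField} [IsGalois ℚ L] (ι₁ : L →+* ℂ)
  {μ : Literature.NumberTheory.Automorphic.IdeleClassGroup L →ₜ* Circle} {hμ : IsConjugateSymplectic L μ} {hw : HasWeight L μ 1} {Car : Def45.Carriers L μ}
  (X : Def45.CMDatum (AlgHom.id ℚ L) ι₁ hμ hw Car)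
  (α₀ : ℂ ⊗[ℚ] bettiCohomology (letI := ι₁.toAlgebra; (X.A.baseChange ℂ).X) 1)
  (hα₀ : letI := ι₁.toAlgebra; haveI := hμ.numberField_muAlgValueField
    ∀ k : muAlgValueField L μ,
      (hOneAlgHom ((AbelianVariety.endAlgebra.mapRingHom (X.A.endBaseChange ℂ)).toRingHom.comp X.i) k).baseChange ℂ α₀ =
        ((k : muAlgValueField L μ) : ℂ) • α₀)
  (hα₀0 : α₀ ≠ 0)

/-- **S1 (data) at the pin — `dLiu q`**: LIU'S OWN CM datum `D_μ = X` ([Liu2021] Def. 4.5 (2)) read as a model CM record, its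
eigenclass scaled by `q : ℚ` (assembler DECISION #2 / prove-4 l.10782): `K' := M'_μ = reflexField ℚ L (algValuedIn ι₁ Φ_μ)`,
`Φ' := Ψ_μ = (reflexCMType ι₁ Φ_μ id).1`, `M := M_μ`, `k := e_μ = Def45.incl`, `(A, ιA, θA) := (liuModel, liuModelRing, liuModelAction)`
(the principal model of `A_μ ⊗_{L,ι₁} ℂ` with its `𝓞_{M_μ}`-structure), `ΦA := Ψ̃_μ` (THE INFLATED REFLEX TYPE), `τ := (M_μ ⊆ ℂ)`,
`α := q • liuModelClass`. [cite: Liu2021, Def. 4.5 (2) (FJcycle.tex l. 1944–1951), Def. 4.3 (2) (l. 1919), §4.1 l. 1928] -/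
def dLiu (q : ℚ) : LiuCMSide where
  K' := ↥(reflexField ℚ L (algValuedIn ι₁ hμ.cmType.1))
  Φ' := (reflexCMType ι₁ hμ.cmType (AlgHom.id ℚ L)).1
  M := ↥(muAlgValueField L μ)
  instNumberFieldM := hμ.numberField_muAlgValueField
  k := Def45.incl (AlgHom.id ℚ L) ι₁ hμ
  A := liuModel ι₁ X α₀ hα₀ hα₀0
  ιA := liuModelRing ι₁ X α₀ hα₀ hα₀0
  θA := liuModelAction ι₁ X α₀ hα₀ hα₀0
  ΦA := inducedCMType (Def45.incl (AlgHom.id ℚ L) ι₁ hμ) (reflexCMType ι₁ hμ.cmType (AlgHom.id ℚ L))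
  hΦA := fun θ => mem_inducedCMType_iff _ _ θ
  isRealisation := liuModel_isCMTypeRealisation ι₁ X α₀ hα₀ hα₀0
  τ := (muAlgValueField L μ).subtype
  α := (q : ℂ) • liuModelClass ι₁ X α₀ hα₀ hα₀0
  α_mem := Submodule.smul_mem _ _ (liuModelClass_mem_eigenline ι₁ X α₀ hα₀ hα₀0)

/-- the record's abelian variety is the principal model `liuModel` (for every `q`). [cite: Shimura1998, §7.1 Proposition 7 (p. 47)] -/
@[simp] theorem dLiu_A (q : ℚ) : (dLiu ι₁ X α₀ hα₀ hα₀0 q).A = liuModel ι₁ X α₀ hα₀ hα₀0 := rfl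

/-- the record's class is `q • α'`, `α' = liuModelClass` Liu's eigenclass on the principal model. [cite: Liu2021, proof of Thm. 4.18 (FJcycle.tex l. 2250)] -/
@[simp] theorem dLiu_α (q : ℚ) : (dLiu ι₁ X α₀ hα₀ hα₀0 q).α = (q : ℂ) • liuModelClass ι₁ X α₀ hα₀ hα₀0 := rfl

/-- the record's embedding `τ` is the inclusion `M_μ ⊆ ℂ`. [cite: Liu2021, Def. 4.3 (FJcycle.tex l. 1908–1912)] -/
@[simp] theorem dLiu_τ (q : ℚ) : (dLiu ι₁ X α₀ hα₀ hα₀0 q).τ = (muAlgValueField L μ).subtype := rfl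

/-- **S1 (law) at the pin — `admLiu q`**: `dLiu q` IS ADMISSIBLE for `Φ_μ` in the package sense `IsReflexOfTypeG ι₁ Φ_μ` — it presents
the TREE reflex pair on the nose (R2 = ✔ `Transposition.isReflexOfType_of_reflexCMType` at `e := RingEquiv.refl`, `Def45.coe_incl`).
ONE proof for every `q` (the predicate reads only `(K', Φ', k, τ)`).  At the index line `i` the pin rewrites `Φ_{μ_i} = (line i).lineType`
(X3-Char) to get `(liuDictionaryPin …).adm i (dLiu q)`. [cite: Liu2021, Def. 4.3 (2) (FJcycle.tex l. 1919) and Def. 4.5 (2)] [cite: Shimura1998, §8.3 Prop. 28] -/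
theorem admLiu (q : ℚ) : (dLiu ι₁ X α₀ hα₀ hα₀0 q).IsReflexOfTypeG ι₁ hμ.cmType := fun _ =>
  Transposition.isReflexOfType_of_reflexCMType ι₁ hμ.cmType (dLiu ι₁ X α₀ hα₀ hα₀0 q) (RingEquiv.refl _)
    (RingHom.ext fun k => Def45.coe_incl (AlgHom.id ℚ L) ι₁ hμ k)
    (fun _ => Iff.of_eq (congrArg (fun χ => χ ∈ (reflexCMType ι₁ hμ.cmType (AlgHom.id ℚ L)).1) (RingHom.ext fun _ => rfl)))

/-- **`admLiu` transported along a type identification `Φ_μ = Φ'`** — the socket of the pinned dictionary, whose admissibility predicate is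
read at the index line's type: `adm i d := d.IsReflexOfTypeG ι₁ (line i).lineType` with `(line i).lineType = Φ_{μ_i}` (X3-Char).
[cite: Liu2021, Def. 4.3 (2) (FJcycle.tex l. 1919) and Def. 4.5 (2)] -/
theorem admLiu_of_eq (q : ℚ) (Φ' : CMType L) (hΦ' : hμ.cmType = Φ') : (dLiu ι₁ X α₀ hα₀ hα₀0 q).IsReflexOfTypeG ι₁ Φ' :=
  hΦ' ▸ admLiu ι₁ X α₀ hα₀ hα₀0 q

/-- **The S4 law for `dLiu`**: `(f ≫ u)^* (dLiu q).α = q • f^* α₀` for every `ℂ`-morphism `f : Y ⟶ A_μ ⊗ ℂ`, `u = liuModelIso`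
(so S4's `f_of φ := f_φ ≫ liuModelIso …` and `geom_eq` is a statement on Liu's own `A_μ ⊗ ℂ`). [cite: MumfordAV1970, §19 Remark p. 169] -/
theorem baseChange_pull_dLiu_α (q : ℚ) :
    letI := ι₁.toAlgebra
    ∀ (Y : SchemeOver ℂ) (f : Y ⟶ (X.A.baseChange ℂ).X),
      (BettiUniverse.pull (f ≫ (liuModelIso ι₁ X α₀ hα₀ hα₀0).hom.hom.hom) 1).baseChange ℂ (dLiu ι₁ X α₀ hα₀ hα₀0 q).α =
        (q : ℂ) • (BettiUniverse.pull f 1).baseChange ℂ α₀ :=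
  baseChange_pull_comp_liuModelIso_smul ι₁ X α₀ hα₀ hα₀0 q

end Pin

end Summit.HodgeConjecture.CorCM.D2Bridge

end
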